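import Literature.Claims.NS.Dou2026c
import Literature.Analysis.FluidPDE.ParallelShearFlow
import HarnessLib

/-!
# C54 `Dou2026c` — the (β) branch: a NON-ZERO admissible disturbance with a global smooth solution

Text of record: Hua-Shu Dou, «Disproving the Existence of Global Smooth Solutions to the
Three-Dimensional Navier–Stokes Equations for Plane Poiseuille Flow», Preprints.org 202509.1747 v3
(2026), PDF pages. Skeleton `Literature.Claims.NS.Dou2026c` rev 2 (typist-3 g2, p484616):
`claim_of_steps Recr : Step1_vanishingPoint Recr → Step2_thm31 → Step3_16to21 → Step4_positivity →
ClaimedTheorem Recr`.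

Referee ref-2 g2's F2 reading «small disturbance means v₀ ≠ 0» (RETYPE df2ba865a16e3585 §1 (i)) is
met here AT THE PRINTED CLASS: the Poiseuille flow plus a decaying Stokes mode,
`u(t,x) = [(G/2ν)(h² − x₁²) + B e^{−ν k² t} cos(k x₁)] e₀`, `k = π/(2h)`, `p = −G x₀`,
is a plane parallel shear flow (Acheson 1990 §2.3; tree `ParallelShear.isClassicalNSSolutionOn_shear`,
p484187), hence a global smooth solution of the typed channel problem: unforced momentum and
`∇·u = 0` everywhere, no-slip at `x₁ = ±h` (`cos(±π/2) = 0`), pressure-driven with remainder `0`,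
bounded on the slab; its datum is `U₀ + v₀` with `v₀ = B cos(k x₁) e₀`, which for `0 ≤ B`,
`B k < G h/(2ν)` (e.g. `B = G h²/(8ν)`) is an ADMISSIBLE disturbance (smooth, divergence free, zero
on the walls, pointwise smaller than `U₀` in the open slab since `cos(k y) = sin(k(h − |y|)) ≤
k(h − |y|)`), and NON-ZERO.

* `heatMode_isChannelSolution`, `vB_admissible`, `heatMode_initial`;
* `exists_nonzero_admissible_globalSolution` — for EVERY `ν, G, h > 0`: a non-zero admissible `v₀`
  with a global smooth channel solution from `U₀ + v₀` along which `∂ₜu ≠ 0` everywhere inside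
  (`∂ₜu = −ν k² B e^{−ν k² t} cos(k x₁) e₀`, `B = Gh²/(8ν)`);
* `not_Step1_vanishingPoint_nonzero Recr`, `not_ClaimedTheorem_nonzero Recr` — §4.2 Step 1 (2)–(3)
  with (20), PDF p.12, and Theorem 4.1 PDF p.10 («no global smooth solutions») are false EVEN WHEN
  RESTRICTED to non-zero admissible disturbances (the referee's charitable re-typing R#1; witness
  `ν = h = 1`, `G = 2(|Recr|+1)`, `v₀ = (G/8) cos(πx₁/2) e₀`); the part-(α) negations follow by logic
  (the restricted statements are weaker), and are not re-declared here (one kernel theorem per statement).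

The (α) branch (`v₀ = 0`, the steady base flow itself; the plain negations `¬ Step1_vanishingPoint Recr`,
`¬ ClaimedTheorem Recr`, `¬ ClaimedTheoremE`) is `SoloRefuteDou2026c.lean` (p486405).

WHAT THIS IS NOT: not a claim about NS regularity or blow-up; not a claim about any author beyond the
typed locator.
-/

noncomputable section

open Set Filter Function Real
open scoped Topology ContDiff Laplacian

-- the cell's Theorems namespace repeats the summit name (convention); silence the duplicate-namespace linter
set_option linter.dupNamespace false

namespace Summit.NavierStokesRegularity.NavierStokesRegularity.Theorems.Dou2026c

open Literature.Analysis.FluidPDE Literature.Analysis.FluidPDE.ParallelShear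
open Literature.Claims.NS.Dou2026c
open Literature.Claims.NS.Dou2026b (e h1LocalSq)

/-! ## The profile -/

/-- The wave number `k = π/(2h)` of the first Stokes mode vanishing on the walls. [cite: Acheson1990, §2.3] -/
def kk (h : ℝ) : ℝ := π / (2 * h)

/-- `k h = π/2`. [folklore] -/
theorem kk_mul_h {h : ℝ} (hh : h ≠ 0) : kk h * h = π / 2 := by
  rw [kk]; field_simp

/-- The profile `φ_B(t, y) = (G/2ν)(h² − y²) + B e^{−ν k² t} cos(k y)`. [cite: Acheson1990, §2.3 eqs. (2.8)–(2.9)] -/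
def phiB (ν G h B : ℝ) (t y : ℝ) : ℝ :=
  G / (2 * ν) * (h ^ 2 - y ^ 2) + B * exp (-(ν * kk h ^ 2) * t) * cos (kk h * y)

/-- The disturbance `v₀ = B cos(k x₁) e₀`. [cite: Dou2026c, §2.1 PDF p.5] -/
def vB (h B : ℝ) (x : EuclideanSpace ℝ (Fin 3)) : EuclideanSpace ℝ (Fin 3) :=
  (B * cos (kk h * x 1)) • e 0

variable (ν G h B : ℝ)

/-- `φ_B` is jointly smooth. [folklore] -/
theorem contDiff_phiB : ContDiff ℝ ∞ (uncurry (phiB ν G h B)) := by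
  show ContDiff ℝ ∞ (fun q : ℝ × ℝ =>
    G / (2 * ν) * (h ^ 2 - q.2 ^ 2) + B * exp (-(ν * kk h ^ 2) * q.1) * cos (kk h * q.2))
  fun_prop

/-- `∂ₜφ_B = −ν k² B e^{−ν k² t} cos(k y)`. [folklore] -/
theorem hasDerivAt_phiB_t (t y : ℝ) :
    HasDerivAt (fun τ => phiB ν G h B τ y)
      (B * (exp (-(ν * kk h ^ 2) * t) * (-(ν * kk h ^ 2))) * cos (kk h * y)) t := by
  have he : HasDerivAt (fun τ => exp (-(ν * kk h ^ 2) * τ))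
      (exp (-(ν * kk h ^ 2) * t) * (-(ν * kk h ^ 2))) t := by
    have h0 := ((hasDerivAt_id' t).const_mul (-(ν * kk h ^ 2))).exp
    convert h0 using 1
    ring
  exact ((he.const_mul B).mul_const (cos (kk h * y))).const_add (G / (2 * ν) * (h ^ 2 - y ^ 2))

/-- `∂_y φ_B = −(G/ν) y − B e^{−ν k² t} k sin(k y)`. [folklore] -/
theorem hasDerivAt_phiB_y (t y : ℝ) :
    HasDerivAt (phiB ν G h B t)
      (-(G / ν) * y - B * exp (-(ν * kk h ^ 2) * t) * kk h * sin (kk h * y)) y := by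
  have h1 := ((hasDerivAt_pow 2 y).const_sub (h ^ 2)).const_mul (G / (2 * ν))
  have h2 := (((hasDerivAt_id' y).const_mul (kk h)).cos).const_mul (B * exp (-(ν * kk h ^ 2) * t))
  refine (h1.add h2).congr_deriv ?_
  simp only [Nat.cast_ofNat, Nat.add_one_sub_one, pow_one, mul_one]
  ring

/-- `∂_y φ_B` as a function. [folklore] -/
theorem deriv_phiB (t : ℝ) :
    deriv (phiB ν G h B t) =
      fun y => -(G / ν) * y - B * exp (-(ν * kk h ^ 2) * t) * kk h * sin (kk h * y) :=
  funext fun y => (hasDerivAt_phiB_y ν G h B t y).deriv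

/-- `∂²_y φ_B = −G/ν − B e^{−ν k² t} k² cos(k y)`. [folklore] -/
theorem hasDerivAt_deriv_phiB (t y : ℝ) :
    HasDerivAt (deriv (phiB ν G h B t))
      (-(G / ν) - B * exp (-(ν * kk h ^ 2) * t) * kk h ^ 2 * cos (kk h * y)) y := by
  rw [deriv_phiB ν G h B t]
  have h1 := (hasDerivAt_id' y).const_mul (-(G / ν))
  have h2 := (((hasDerivAt_id' y).const_mul (kk h)).sin).const_mul
    (B * exp (-(ν * kk h ^ 2) * t) * kk h)
  refine (h1.sub h2).congr_deriv ?_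
  ring

/-! ## The flow is a classical solution and a channel solution -/

/-- The reduced equation `∂ₜφ = ν ∂²_y φ + 0 + G` holds, so `(φ_B e₀, −G x₀)` is a classical
Navier–Stokes solution with zero force on `[0, ∞) × ℝ³`. [cite: Acheson1990, §2.3 eqs. (2.8)–(2.9)] -/
theorem heatMode_isClassical (hν : 0 < ν) :
    IsClassicalNSSolutionOn (Ici 0) ν (shearForce fun _ _ => 0) (shearVelocity (phiB ν G h B))
      (shearPressure fun _ => G) := by
  refine isClassicalNSSolutionOn_shear (uniqueDiffOn_Ici 0) (contDiff_phiB ν G h B).contDiffOn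
    contDiffOn_const fun t ht y => ?_
  rw [(hasDerivAt_phiB_t ν G h B t y).hasDerivWithinAt.derivWithin (uniqueDiffOn_Ici 0 t ht),
    (hasDerivAt_deriv_phiB ν G h B t y).deriv]
  field_simp
  ring

/-- **The Poiseuille flow plus the decaying Stokes mode is a solution of the typed channel problem
on `[0, ∞)`** (rev-2 class: momentum and incompressibility in the slab, no-slip, pressure-driven
with remainder `0`, bounded). [cite: Dou2026c, eq. (3), §2.1 PDF p.4–5, Appendix §8.1 PDF p.18; Acheson1990, §2.3] -/
theorem heatMode_isChannelSolution (hν : 0 < ν) (hh : 0 < h) :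
    IsChannelSolutionOn (Ici 0) ν G h (shearVelocity (phiB ν G h B)) (shearPressure fun _ => G) := by
  have hc := heatMode_isClassical ν G h B hν
  refine ⟨hc.smooth_velocity, hc.smooth_pressure, ?_, ?_, ?_, ?_, ?_⟩
  · intro t ht x _
    have hm := hc.momentum t ht x
    simpa [shearForce] using hm
  · intro t ht x _
    exact hc.divFree t ht x
  · intro t _ x hx
    have hcos : cos (kk h * x 1) = 0 := by
      rcases hx with hx | hx
      · rw [hx, kk_mul_h hh.ne', cos_pi_div_two]
      · rw [hx, mul_neg, kk_mul_h hh.ne', cos_neg, cos_pi_div_two]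
    have hsq : h ^ 2 - (x 1) ^ 2 = 0 := by
      rcases hx with hx | hx <;> rw [hx] <;> ring
    simp [shearVelocity, phiB, hcos, hsq]
  · intro t _
    exact ⟨0, fun x _ => by simp [shearPressure]⟩
  · intro t _
    refine ⟨|G / (2 * ν)| * h ^ 2 + |B| * exp (-(ν * kk h ^ 2) * t), fun x hx => ?_⟩
    have he : ‖EuclideanSpace.single (0 : Fin 3) (1 : ℝ)‖ = 1 := by simp
    have h1 : 0 < h ^ 2 - (x 1) ^ 2 := by nlinarith [hx.1, hx.2]
    have h2 : h ^ 2 - (x 1) ^ 2 ≤ h ^ 2 := by nlinarith [sq_nonneg (x 1)]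
    rw [shearVelocity, norm_smul, he, mul_one, Real.norm_eq_abs, phiB]
    calc |G / (2 * ν) * (h ^ 2 - (x 1) ^ 2) + B * exp (-(ν * kk h ^ 2) * t) * cos (kk h * x 1)|
        ≤ |G / (2 * ν) * (h ^ 2 - (x 1) ^ 2)| + |B * exp (-(ν * kk h ^ 2) * t) * cos (kk h * x 1)| :=
          abs_add_le _ _
      _ ≤ |G / (2 * ν)| * h ^ 2 + |B| * exp (-(ν * kk h ^ 2) * t) := by
          gcongr
          · rw [abs_mul, abs_of_pos h1]
            exact mul_le_mul_of_nonneg_left h2 (abs_nonneg _)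
          · rw [abs_mul, abs_mul, abs_of_pos (exp_pos _)]
            exact mul_le_of_le_one_right (by positivity) (abs_cos_le_one _)

/-- Its datum is `U₀ + v₀`. [cite: Dou2026c, §2.1 PDF p.5] -/
theorem heatMode_initial (x : EuclideanSpace ℝ (Fin 3)) :
    shearVelocity (phiB ν G h B) 0 x = poiseuille ν G h x + vB h B x := by
  simp only [shearVelocity, phiB, mul_zero, exp_zero, mul_one, poiseuille, vB, e, add_smul]

/-! ## The disturbance is admissible -/

/-- In the open slab, `cos(k x₁) = sin(k(h − |x₁|))`, with `0 ≤ k(h − |x₁|) ≤ π/2`. [folklore] -/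
theorem cos_kk_eq {h : ℝ} (hh : 0 < h) (x : EuclideanSpace ℝ (Fin 3)) :
    cos (kk h * x 1) = sin (kk h * (h - |x 1|)) := by
  have hk : 0 < kk h := by rw [kk]; positivity
  rw [← Real.cos_abs (kk h * x 1), abs_mul, abs_of_pos hk, mul_sub, kk_mul_h hh.ne',
    Real.sin_pi_div_two_sub]

/-- **`v₀ = B cos(k x₁) e₀` is an admissible disturbance** for `0 ≤ B` with `B k < G h/(2ν)`:
smooth, divergence free, zero on the walls, and `|v₀| < |U₀|` in the open slab.
[cite: Dou2026c, §2.1 PDF p.5 l.8–17] -/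
theorem vB_admissible (hν : 0 < ν) (hG : 0 < G) (hh : 0 < h) (hB0 : 0 ≤ B)
    (hB : B * kk h < G / (2 * ν) * h) : IsAdmissibleDisturbance ν G h (vB h B) := by
  have he : ‖(e 0 : EuclideanSpace ℝ (Fin 3))‖ = 1 := by simp [e]
  have hk : 0 < kk h := by rw [kk]; positivity
  have hc1 : ContDiff ℝ ∞ (fun x : EuclideanSpace ℝ (Fin 3) => x 1) :=
    (EuclideanSpace.proj (1 : Fin 3) : EuclideanSpace ℝ (Fin 3) →L[ℝ] ℝ).contDiff
  refine ⟨?_, fun x _ => ?_, fun x hx => ?_, fun x hx => ?_⟩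
  · exact (contDiff_const.mul (contDiff_const.mul hc1).cos).smul contDiff_const
  · have hd : DifferentiableAt ℝ (fun s : ℝ => B * cos (kk h * s)) (x 1) := by fun_prop
    exact divergence_profile hd
  · have hcos : cos (kk h * x 1) = 0 := by
      rcases hx with hx | hx
      · rw [hx, kk_mul_h hh.ne', cos_pi_div_two]
      · rw [hx, mul_neg, kk_mul_h hh.ne', cos_neg, cos_pi_div_two]
    simp [vB, hcos]
  · have ha0 : 0 ≤ |x 1| := abs_nonneg _
    have hah : |x 1| < h := abs_lt.2 ⟨hx.1, hx.2⟩
    have hθ0 : 0 ≤ kk h * (h - |x 1|) := mul_nonneg hk.le (sub_nonneg.2 hah.le)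
    have hθπ : kk h * (h - |x 1|) ≤ π := by
      have h1 : kk h * (h - |x 1|) ≤ kk h * h := mul_le_mul_of_nonneg_left (by linarith) hk.le
      rw [kk_mul_h hh.ne'] at h1
      linarith [pi_pos]
    have hsin_le : sin (kk h * (h - |x 1|)) ≤ kk h * (h - |x 1|) := Real.sin_le hθ0
    have hsin_nn : 0 ≤ sin (kk h * (h - |x 1|)) := Real.sin_nonneg_of_nonneg_of_le_pi hθ0 hθπ
    have hcν : 0 < G / (2 * ν) := by positivity
    have h1 : 0 < h ^ 2 - (x 1) ^ 2 := by nlinarith [hx.1, hx.2]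
    have hpois : ‖poiseuille ν G h x‖ = G / (2 * ν) * (h ^ 2 - (x 1) ^ 2) := by
      rw [poiseuille, norm_smul, he, mul_one, Real.norm_eq_abs, abs_of_pos (mul_pos hcν h1)]
    have hv : ‖vB h B x‖ = B * sin (kk h * (h - |x 1|)) := by
      rw [vB, norm_smul, he, mul_one, cos_kk_eq hh, Real.norm_eq_abs,
        abs_of_nonneg (mul_nonneg hB0 hsin_nn)]
    rw [hv, hpois, ← sq_abs (x 1)]
    have hstrict : B * kk h * (h - |x 1|) < G / (2 * ν) * h * (h - |x 1|) :=
      mul_lt_mul_of_pos_right hB (sub_pos.2 hah)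
    nlinarith [mul_le_mul_of_nonneg_left hsin_le hB0, hstrict,
      mul_nonneg (mul_nonneg hcν.le ha0) (sub_nonneg.2 hah.le)]

/-- The choice `B = G h²/(8ν)` is admissible (`B k = (G h/2ν)(π/8) < G h/2ν` as `π ≤ 4`) and
positive. [folklore] -/
theorem bChoice_lt (hν : 0 < ν) (hG : 0 < G) (hh : 0 < h) :
    G * h ^ 2 / (8 * ν) * kk h < G / (2 * ν) * h := by
  have hpos : 0 < G / (2 * ν) * h := by positivity
  have heq : G * h ^ 2 / (8 * ν) * kk h = G / (2 * ν) * h * (π / 8) := by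
    rw [kk]; field_simp
  rw [heq]
  exact mul_lt_of_lt_one_right hpos (by linarith [pi_le_four])

/-! ## The time derivative never vanishes inside the channel -/

/-- `∂ₜu(t, x) = −ν k² B e^{−ν k² t} cos(k x₁) e₀` for `t ≥ 0` (one-sided within `[0, ∞)`). [folklore] -/
theorem timeDerivWithin_heatMode {t : ℝ} (ht : 0 ≤ t) (x : EuclideanSpace ℝ (Fin 3)) :
    timeDerivWithin (Ici 0) (shearVelocity (phiB ν G h B)) t x =
      (B * (exp (-(ν * kk h ^ 2) * t) * (-(ν * kk h ^ 2))) * cos (kk h * x 1)) •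
        EuclideanSpace.single (0 : Fin 3) (1 : ℝ) := by
  rw [timeDerivWithin_apply]
  exact (((hasDerivAt_phiB_t ν G h B t (x 1)).hasDerivWithinAt).smul_const _).derivWithin
    (uniqueDiffOn_Ici 0 t ht)

/-- In the open slab `cos(k x₁) > 0`. [folklore] -/
theorem cos_kk_pos {h : ℝ} (hh : 0 < h) {x : EuclideanSpace ℝ (Fin 3)} (hx : x ∈ slab h) :
    0 < cos (kk h * x 1) := by
  have hk : 0 < kk h := by rw [kk]; positivity
  have hah : |x 1| < h := abs_lt.2 ⟨hx.1, hx.2⟩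
  rw [cos_kk_eq hh]
  refine Real.sin_pos_of_pos_of_lt_pi (mul_pos hk (sub_pos.2 hah)) ?_
  have h1 : kk h * (h - |x 1|) ≤ kk h * h :=
    mul_le_mul_of_nonneg_left (by linarith [abs_nonneg (x 1)]) hk.le
  rw [kk_mul_h hh.ne'] at h1
  linarith [pi_pos]

/-! ## The (β) reading in kernel form: statements genuinely different from part (α)

The three headline negations `¬ Step1_vanishingPoint Recr`, `¬ ClaimedTheorem Recr`, `¬ ClaimedTheoremE` are
ALREADY in the tree from part (α) (`SoloRefuteDou2026c.lean`, p486405; one kernel theorem per statement).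
Here the (β) content is recorded as (1) a positive existence statement — for EVERY `ν, G, h > 0` a NON-ZERO
admissible disturbance with a global smooth channel solution whose time derivative never vanishes in the
slab — and (2) the negations of the referee's CHARITABLE RE-TYPINGS of Step 1 and Theorem 4.1 with the
extra hypothesis `v₀ ≠ 0` (R#1: «small disturbance means v₀ ≠ 0»), which are strictly stronger than the
part-(α) negations. -/

/-- The disturbance `vB h B` is not the zero field when `B ≠ 0` (`v₀(0) = B e₀`). [folklore] -/
theorem vB_ne_zero {h B : ℝ} (hB : B ≠ 0) : vB h B ≠ 0 := by
  intro h0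
  have h00 := congrFun h0 0
  have he : ‖(e 0 : EuclideanSpace ℝ (Fin 3))‖ = 1 := by simp [e]
  have hn := congrArg (fun v : EuclideanSpace ℝ (Fin 3) => ‖v‖) h00
  simp only [vB, PiLp.zero_apply, mul_zero, cos_zero, mul_one, norm_smul, he, Real.norm_eq_abs,
    Pi.zero_apply, norm_zero] at hn
  exact hB (abs_eq_zero.1 hn)

/-- `∂ₜu ≠ 0` at every interior point and every time `t ≥ 0` when `B ≠ 0`. [folklore] -/
theorem timeDerivWithin_heatMode_ne_zero (hν : 0 < ν) (hh : 0 < h) (hB : B ≠ 0) {t : ℝ} (ht : 0 ≤ t)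
    {x : EuclideanSpace ℝ (Fin 3)} (hx : x ∈ slab h) :
    timeDerivWithin (Ici 0) (shearVelocity (phiB ν G h B)) t x ≠ 0 := by
  rw [timeDerivWithin_heatMode ν G h B ht]
  have hk : 0 < kk h := by rw [kk]; positivity
  have hne : B * (exp (-(ν * kk h ^ 2) * t) * (-(ν * kk h ^ 2))) * cos (kk h * x 1) ≠ 0 := by
    refine mul_ne_zero (mul_ne_zero hB (mul_ne_zero (exp_pos _).ne' ?_)) (cos_kk_pos hh hx).ne'
    have : 0 < ν * kk h ^ 2 := by positivity
    linarith
  intro h0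
  rw [smul_eq_zero] at h0
  rcases h0 with h0 | h0
  · exact hne h0
  · have : ‖EuclideanSpace.single (0 : Fin 3) (1 : ℝ)‖ = 1 := by simp
    rw [h0, norm_zero] at this
    exact zero_ne_one this

/-- **(β), positive form: for EVERY `ν, G, h > 0` (hence every Reynolds number) there is a NON-ZERO
admissible small disturbance `v₀` of the Poiseuille flow with a GLOBAL smooth solution of the typed
channel problem issued from `U₀ + v₀`, along which `∂ₜu` never vanishes inside the channel** (so
neither the `(x*, t*)` of Step 1 (2)–(3) PDF p.12 nor the non-existence of Theorem 4.1 PDF p.10 can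
hold, whatever `Re_cr`). Witness: `v₀ = B cos(πx₁/2h) e₀`, `B = Gh²/(8ν)`, the decaying Stokes mode.
[cite: Dou2026c, Theorem 4.1 PDF p.10 l.37–51; §4.2 Step 1 (2)–(3) eq. (20) PDF p.12; Acheson1990, §2.3] -/
theorem exists_nonzero_admissible_globalSolution (hν : 0 < ν) (hG : 0 < G) (hh : 0 < h) :
    ∃ v₀ : EuclideanSpace ℝ (Fin 3) → EuclideanSpace ℝ (Fin 3),
      v₀ ≠ 0 ∧ IsAdmissibleDisturbance ν G h v₀ ∧
      ∃ (u : ℝ → EuclideanSpace ℝ (Fin 3) → EuclideanSpace ℝ (Fin 3))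
        (p : ℝ → EuclideanSpace ℝ (Fin 3) → ℝ),
        IsChannelSolutionOn (Ici 0) ν G h u p ∧ (∀ x ∈ slab h, u 0 x = poiseuille ν G h x + v₀ x) ∧
          ∀ t : ℝ, 0 ≤ t → ∀ x ∈ slab h, timeDerivWithin (Ici 0) u t x ≠ 0 := by
  set B : ℝ := G * h ^ 2 / (8 * ν) with hB
  have hB0 : 0 < B := by rw [hB]; positivity
  exact ⟨vB h B, vB_ne_zero hB0.ne',
    vB_admissible ν G h B hν hG hh hB0.le (bChoice_lt ν G h hν hG hh),
    shearVelocity (phiB ν G h B), shearPressure fun _ => G, heatMode_isChannelSolution ν G h B hν hh,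
    fun x _ => heatMode_initial ν G h B x,
    fun t ht x hx => timeDerivWithin_heatMode_ne_zero ν G h B hν hh hB0.ne' ht hx⟩

/-- **Step 1 (§4.2 Step 1 (2)–(3) with (20), PDF p.12) is false EVEN WHEN RESTRICTED TO NON-ZERO
admissible disturbances** (the referee's charitable re-typing R#1; strictly stronger than
`not_Step1_vanishingPoint` of part (α)): witness `ν = h = 1`, `G = 2(|Recr|+1)` (`Re = G/2 > Recr`),
`v₀ = (G/8) cos(πx₁/2) e₀`. [cite: Dou2026c, §4.2 Step 1 (2)–(3), eq. (20) PDF p.12; §3.2 item 2(b) PDF p.9] -/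
theorem not_Step1_vanishingPoint_nonzero (Recr : ℝ) :
    ¬ ∀ (ν G h : ℝ) (v₀ : EuclideanSpace ℝ (Fin 3) → EuclideanSpace ℝ (Fin 3))
        (u : ℝ → EuclideanSpace ℝ (Fin 3) → EuclideanSpace ℝ (Fin 3))
        (p : ℝ → EuclideanSpace ℝ (Fin 3) → ℝ),
        0 < ν → 0 < G → 0 < h → IsAdmissibleDisturbance ν G h v₀ → v₀ ≠ 0 →
        Recr < reynoldsP ν G h → IsChannelSolutionOn (Ici 0) ν G h u p →
        (∀ x ∈ slab h, u 0 x = poiseuille ν G h x + v₀ x) →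
          ∃ tstar : ℝ, 0 < tstar ∧ ∃ xstar ∈ slab h, ∃ ε : ℝ, 0 < ε ∧ Metric.ball xstar ε ⊆ slab h ∧
            timeDerivWithin (Ici 0) u tstar xstar = 0 ∧
            Tendsto (fun t => h1LocalSq (Δ (u t)) xstar ε) (𝓝[<] tstar) (𝓝 0) := by
  intro h1
  set G : ℝ := 2 * (|Recr| + 1) with hG
  have hGpos : 0 < G := by rw [hG]; positivity
  have hRe : Recr < reynoldsP 1 G 1 := by
    rw [reynoldsP, hG]; norm_num; linarith [le_abs_self Recr]
  obtain ⟨v₀, hv0, hadm, u, p, hsol, hinit, hdt⟩ :=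
    exists_nonzero_admissible_globalSolution 1 G 1 one_pos hGpos one_pos
  obtain ⟨ts, hts, xs, hxs, ε, _, _, hzero, _⟩ := h1 1 G 1 v₀ u p one_pos hGpos one_pos hadm hv0 hRe hsol hinit
  exact hdt ts hts.le xs hxs hzero

/-- **Theorem 4.1's operative clause («no global smooth solutions», PDF p.10 l.37–51) is false EVEN
WHEN RESTRICTED TO NON-ZERO admissible small disturbances** (referee's R#1; strictly stronger than
`not_ClaimedTheorem_baseFlow` of part (α)). [cite: Dou2026c, Theorem 4.1 PDF p.10 l.37–51] -/
theorem not_ClaimedTheorem_nonzero (Recr : ℝ) :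
    ¬ ∀ (ν G h : ℝ) (v₀ : EuclideanSpace ℝ (Fin 3) → EuclideanSpace ℝ (Fin 3)),
        0 < ν → 0 < G → 0 < h → IsAdmissibleDisturbance ν G h v₀ → v₀ ≠ 0 → Recr < reynoldsP ν G h →
          ¬ ∃ (u : ℝ → EuclideanSpace ℝ (Fin 3) → EuclideanSpace ℝ (Fin 3))
              (p : ℝ → EuclideanSpace ℝ (Fin 3) → ℝ),
              IsChannelSolutionOn (Ici 0) ν G h u p ∧ ∀ x ∈ slab h, u 0 x = poiseuille ν G h x + v₀ x := by
  intro hC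
  set G : ℝ := 2 * (|Recr| + 1) with hG
  have hGpos : 0 < G := by rw [hG]; positivity
  have hRe : Recr < reynoldsP 1 G 1 := by
    rw [reynoldsP, hG]; norm_num; linarith [le_abs_self Recr]
  obtain ⟨v₀, hv0, hadm, u, p, hsol, hinit, _⟩ :=
    exists_nonzero_admissible_globalSolution 1 G 1 one_pos hGpos one_pos
  exact hC 1 G 1 v₀ one_pos hGpos one_pos hadm hv0 hRe ⟨u, p, hsol, hinit⟩

end Summit.NavierStokesRegularity.NavierStokesRegularity.Theorems.Dou2026c

end

-- WHAT THIS IS NOT: not a claim about NS regularity or blow-up; not a claim about any author beyond the typed locator.
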